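import Summits.BirchSwinnertonDyer.BirchSwinnertonDyer.Theorems.ResidualThetaTransportAtTwoThetaLayerLambdaCongruenceAtTwoDepletedHeckeAlgebra
import Summits.BirchSwinnertonDyer.BirchSwinnertonDyer.Theorems.ResidualThetaTransportAtTwoThetaLayerLambdaCongruenceAtTwoDoubling
import Literature.NumberTheory.EllipticCurves.PAdicLFunctionDistributionProofs
import Literature.NumberTheory.EllipticCurves.PAdicBSDSplitMultiplicativeProofs
import HarnessLib

/-!
# Crux `ThetaLayerLambdaCongruenceAtTwo` (stmt-BirchSwinnertonDyer-20688, route ResidualThetaTransportAtTwo), line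
# `birth`: the partner's `S₀`-DEPLETED PLUS SYMBOL is an eigenfunction of the FULL Hecke algebra of the depleted level
# — `T_q ↦ ι a_q(g)` off `S₀`, `U_ℓ ↦ 0` on `S₀` (width prover bsd-wall-rtt-p3-w2 g0; `--supports stmt-BirchSwinnertonDyer-20688
# --as helper`; closes nothing)

HONEST FRAMING. THEOREMS of the tree's definitions only; nothing about any curve or form is asserted; BSD is not proved
by any of this.

WHAT. The depleted plus symbol of the partner datum `(g, Ω, ι)` of the crux,
`φ^{S₀}_{g,Ω}(x) = ∑_{k : S₀ → {0,1,2}} (∏_v c_{v,k_v} ℓ_v^{−k_v}) · ι[x·∏_v ℓ_v^{k_v}]⁺_{g,Ω}` (the function whose values at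
`γ^s/2^{n+2}` ARE the coefficients of the crux's `Θ^{S₀}_n(g;Ω)/2`, landed `depletedPartnerLayer_eq_layerSum_depletedSymbol`),
is (§1) the action of the depletion operator `∏_{v∈S₀} P_v(ℓ_v⁻¹[ℓ_v]) ∈ K[ℕ^×]` on `ψ = ι∘[·]⁺_{g,Ω}` (bridge
`act_prod_depletionFactor_eq_sum_piFinset`), and `ψ` satisfies the Hecke relations of `g` (§2, from the tree theorems
`cuspCoeff_mul_plusSymbol` / `…_of_dvd`: `ι a_q·ψ = U_q ψ + 𝟙_{q∤M}[q]ψ`, read in `K_g` at a plus period and pushed along `ι`).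
Hence (§3), by the operator algebra of `…DepletedHeckeAlgebra.lean`:
* `heckeT_depletedPartnerSymbol`: for every prime `q` different from all `ℓ_v` (`v ∈ S₀`),
  `ι a_q(g)·φ^{S₀}(r) = ∑_{j<q} φ^{S₀}((r+j)/q) + 𝟙_{q∤M} φ^{S₀}(q r)` — `T_q φ^{S₀} = ι a_q(g) φ^{S₀}` off `S₀ ∪ primes(M)`;
* `heckeU_depletedPartnerSymbol_eq_zero`: for every `v₀ ∈ S₀`, `∑_{j<ℓ} φ^{S₀}((r+j)/ℓ) = 0`, `ℓ = ℓ_{v₀}` — `U_ℓ φ^{S₀} = 0`.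
So `φ^{S₀}_{g,Ω}` is an eigenvector of the full Hecke algebra of the depleted (odd) level with eigencharacter
`(T_q ↦ ι a_q(g) (q ∉ S₀), U_ℓ ↦ 0 (ℓ ∈ S₀))`; with the curve-side twin and the crux's `hcong` (+ `a₂ = 0` on both sides)
the two depleted symbols cut out the SAME maximal ideal `𝔪'` — the multiplicity-one input of (H-sym) (Vatsal (1.10) /
Greenberg–Vatsal (10) at `p = 2`; Ribet–Stein 2008 Thm. 3.5 for the habitat's `ρ̄`).

References: [GreenbergVatsal2000] §1 (8), §3; [Vatsal1999] §1; [CremonaAlgorithms1997] §2.4, §2.8;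
[MazurTateTeitelbaum1986Invent] §I.4 (Hecke action on modular symbols).
-/

noncomputable section

-- justification: the `Summit.BirchSwinnertonDyer.BirchSwinnertonDyer.…` path repeats a component (route-file convention)
set_option linter.dupNamespace false

open scoped Classical

open Polynomial

open Literature.NumberTheory.EllipticCurves Literature.NumberTheory.EllipticCurves.ModularForms

namespace Summit.BirchSwinnertonDyer.BirchSwinnertonDyer.Theorems.ThetaLayerLambdaCongruenceAtTwo

/-! ## §1. Bridge: the explicit depleted function is the action of `∏_v ∑_k single (ℓ_v^k) c_{v,k}` -/

section Bridge

variable {K : Type*} [Field K]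

/-- **Bridge.** The action of the product of depletion factors `∏_{v∈S} ∑_{k<3} single (ℓ_v^k) (c_{v,k})` on `ψ` at `x`
is the explicit sum `∑_{k : S → {0,1,2}} (∏_v c_{v,k_v}) · ψ(x·∏_v ℓ_v^{k_v})` (expand the product: `Finset.prod_univ_sum`,
`MonoidAlgebra.prod_single`). [folklore] -/
theorem act_prod_depletionFactor_eq_sum_piFinset (ψ : ℚ → K) {α : Type*} (S : Finset α) (ℓ : α → ℕ)
    (cf : α → ℕ → K) (x : ℚ) :
    ((∏ v ∈ S, ∑ k ∈ Finset.range 3, MonoidAlgebra.single (ℓ v ^ k) (cf v k) : MonoidAlgebra K ℕ).coeff.sum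
        fun m b ↦ b * ψ ((m : ℚ) * x)) =
      ∑ k ∈ Fintype.piFinset (fun _ : S ↦ Finset.range 3),
        (∏ v : S, cf v (k v)) * ψ (x * ((∏ v : S, ℓ v ^ (k v) : ℕ) : ℚ)) := by
  rw [← Finset.prod_coe_sort S, Finset.prod_univ_sum]
  simp_rw [MonoidAlgebra.prod_single]
  rw [act_sum]
  refine Finset.sum_congr rfl fun k _ ↦ ?_
  rw [act_single, mul_comm x]

end Bridge

/-! ## §2. The Hecke relations of the partner's plus symbol, in `K_g` and along `ι` -/

section Partner

variable {M : ℕ} [NeZero M] {g : CuspForm (CongruenceSubgroup.Gamma0 M) 2} {Ω : ℂ}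

/-- **Hecke relation for `[·]⁺_{g,Ω}` in `K_g`**: for a newform `g` on `Γ₀(M)`, a plus period `Ω` and a prime `q`,
`a_q(g)·[r]⁺ = ∑_{j<q} [(r+j)/q]⁺ + 𝟙_{q∤M}·[q r]⁺` in `K_g` (tree theorems `cuspCoeff_mul_plusSymbol`, `…_of_dvd` divided
by `Ω`). [cite: CremonaAlgorithms1997, §2.8] -/
theorem cuspCoeff_mul_plusSymbolK (hg : IsNewform0 g) (hΩ : IsPlusPeriod g Ω) {q : ℕ} (hq : q.Prime) (r : ℚ) :
    (⟨cuspCoeff g q, coeff_mem_coeffField g q⟩ : coeffField g) * plusSymbolK g Ω r =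
      (∑ j : Fin q, plusSymbolK g Ω ((r + j) / q)) +
        (if q ∣ M then 0 else plusSymbolK g Ω ((q : ℚ) * r)) := by
  haveI : NeZero q := ⟨hq.ne_zero⟩
  apply Subtype.ext
  have hΩ0 : Ω ≠ 0 := hΩ.ne_zero
  simp only [IntermediateField.coe_mul, IntermediateField.coe_add, IntermediateField.coe_sum, hΩ.coe_plusSymbolK]
  split_ifs with hqM
  · rw [IntermediateField.coe_zero, add_zero, ← Finset.sum_div, ← cuspCoeff_mul_plusSymbol_of_dvd q hg hq hqM r]
    change cuspCoeff g q * (plusSymbol g r / Ω) = _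
    ring
  · rw [hΩ.coe_plusSymbolK, ← Finset.sum_div, ← add_div, ← cuspCoeff_mul_plusSymbol q hg hq hqM r]
    change cuspCoeff g q * (plusSymbol g r / Ω) = _
    ring

variable (ι : coeffField g →+* PadicAlgCl 2)

/-- **Hecke relation for `ψ = ι∘[·]⁺_{g,Ω}` along `ι`**, in the normalised shape of `…DepletedHeckeAlgebra`:
`ι a_q(g)·ψ(r) = ∑_{j<q} ψ((r+j)/q) + c q⁻¹·ψ(q r)` with `c = 𝟙_{q∤M}·q`. [cite: CremonaAlgorithms1997, §2.8] -/
theorem heckeRel_embPlusSymbol (hg : IsNewform0 g) (hΩ : IsPlusPeriod g Ω) {q : ℕ} (hq : q.Prime) (r : ℚ) :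
    embCoeff g ι q * ι (plusSymbolK g Ω r) =
      (∑ j : Fin q, ι (plusSymbolK g Ω ((r + j) / q))) +
        (if q ∣ M then 0 else (q : PadicAlgCl 2)) * (q : PadicAlgCl 2)⁻¹ * ι (plusSymbolK g Ω ((q : ℚ) * r)) := by
  have h := congrArg ι (cuspCoeff_mul_plusSymbolK hg hΩ hq r)
  rw [map_mul, map_add, map_sum] at h
  rw [embCoeff_def, h]
  have hq0 : (q : PadicAlgCl 2) ≠ 0 := by exact_mod_cast hq.ne_zero
  split_ifs with hqM
  · rw [map_zero, zero_mul, zero_mul]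
  · rw [mul_inv_cancel₀ hq0, one_mul]

/-- The coefficients of the partner's Euler polynomial `1 − ι a_ℓ X + 𝟙_{ℓ∤M} ℓ X²`. [folklore] -/
theorem coeff_partnerEulerPolynomial (b : PadicAlgCl 2) (M ℓ : ℕ) :
    (1 - C b * X + (if ℓ ∣ M then 0 else C (ℓ : PadicAlgCl 2)) * X ^ 2 : (PadicAlgCl 2)[X]).coeff 0 = 1 ∧
    (1 - C b * X + (if ℓ ∣ M then 0 else C (ℓ : PadicAlgCl 2)) * X ^ 2 : (PadicAlgCl 2)[X]).coeff 1 = -b ∧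
    (1 - C b * X + (if ℓ ∣ M then 0 else C (ℓ : PadicAlgCl 2)) * X ^ 2 : (PadicAlgCl 2)[X]).coeff 2 =
      (if ℓ ∣ M then 0 else (ℓ : PadicAlgCl 2)) := by
  refine ⟨?_, ?_, ?_⟩ <;> split_ifs <;> simp [coeff_one, coeff_X, coeff_X_pow]

/-! ## §3. The depleted partner symbol is full-Hecke eigen -/

/-- Distinct places of `ℚ` have coprime generators. [folklore] -/
theorem coprime_natGenerator_of_ne {v w : IsDedekindDomain.HeightOneSpectrum (NumberField.RingOfIntegers ℚ)}
    (h : v ≠ w) : (Rat.HeightOneSpectrum.natGenerator v).Coprime (Rat.HeightOneSpectrum.natGenerator w) := by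
  refine (Nat.coprime_primes (Rat.HeightOneSpectrum.prime_natGenerator v)
    (Rat.HeightOneSpectrum.prime_natGenerator w)).mpr fun heq ↦ h ?_
  exact (Rat.HeightOneSpectrum.primesEquiv (R := NumberField.RingOfIntegers ℚ)).injective (Subtype.ext heq)

/-- **`T_q φ^{S₀}_{g,Ω} = ι a_q(g)·φ^{S₀}_{g,Ω}` for primes `q` off `S₀`** (in relation form, with the `𝟙_{q∤M}` of the
level): for a newform `g`, a plus period `Ω`, any finite set `S₀` of places and any prime `q ≠ ℓ_v` (`v ∈ S₀`),
`ι a_q(g)·φ^{S₀}(r) = ∑_{j<q} φ^{S₀}((r+j)/q) + 𝟙_{q∤M} q·q⁻¹ φ^{S₀}(q r)`, `φ^{S₀}` the explicit depleted plus symbol of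
`depletedPartnerLayer_eq_layerSum_depletedSymbol`. [cite: GreenbergVatsal2000, §1 (8) and §3 (the Σ₀-depleted form is an eigenform for all T_q, q ∉ Σ₀)] -/
theorem heckeT_depletedPartnerSymbol (hg : IsNewform0 g) (hΩ : IsPlusPeriod g Ω)
    (S₀ : Finset (IsDedekindDomain.HeightOneSpectrum (NumberField.RingOfIntegers ℚ))) {q : ℕ} (hq : q.Prime)
    (hqS : ∀ v ∈ S₀, Rat.HeightOneSpectrum.natGenerator v ≠ q) (r : ℚ) :
    embCoeff g ι q * (∑ k ∈ Fintype.piFinset (fun _ : S₀ ↦ Finset.range 3),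
        (∏ v : S₀, (1 - C (embCoeff g ι (Rat.HeightOneSpectrum.natGenerator (v : IsDedekindDomain.HeightOneSpectrum (NumberField.RingOfIntegers ℚ)))) * X + (if Rat.HeightOneSpectrum.natGenerator (v : IsDedekindDomain.HeightOneSpectrum (NumberField.RingOfIntegers ℚ)) ∣ M then 0 else C (Rat.HeightOneSpectrum.natGenerator (v : IsDedekindDomain.HeightOneSpectrum (NumberField.RingOfIntegers ℚ)) : PadicAlgCl 2)) * X ^ 2 : (PadicAlgCl 2)[X]).coeff (k v) *
            ((Rat.HeightOneSpectrum.natGenerator (v : IsDedekindDomain.HeightOneSpectrum (NumberField.RingOfIntegers ℚ)) : PadicAlgCl 2)⁻¹) ^ (k v)) *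
          ι (plusSymbolK g Ω (r * ((∏ v : S₀, Rat.HeightOneSpectrum.natGenerator (v : IsDedekindDomain.HeightOneSpectrum (NumberField.RingOfIntegers ℚ)) ^ (k v) : ℕ) : ℚ)))) =
      (∑ j : Fin q, ∑ k ∈ Fintype.piFinset (fun _ : S₀ ↦ Finset.range 3),
        (∏ v : S₀, (1 - C (embCoeff g ι (Rat.HeightOneSpectrum.natGenerator (v : IsDedekindDomain.HeightOneSpectrum (NumberField.RingOfIntegers ℚ)))) * X + (if Rat.HeightOneSpectrum.natGenerator (v : IsDedekindDomain.HeightOneSpectrum (NumberField.RingOfIntegers ℚ)) ∣ M then 0 else C (Rat.HeightOneSpectrum.natGenerator (v : IsDedekindDomain.HeightOneSpectrum (NumberField.RingOfIntegers ℚ)) : PadicAlgCl 2)) * X ^ 2 : (PadicAlgCl 2)[X]).coeff (k v) *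
            ((Rat.HeightOneSpectrum.natGenerator (v : IsDedekindDomain.HeightOneSpectrum (NumberField.RingOfIntegers ℚ)) : PadicAlgCl 2)⁻¹) ^ (k v)) *
          ι (plusSymbolK g Ω ((r + j) / q * ((∏ v : S₀, Rat.HeightOneSpectrum.natGenerator (v : IsDedekindDomain.HeightOneSpectrum (NumberField.RingOfIntegers ℚ)) ^ (k v) : ℕ) : ℚ)))) +
      (if q ∣ M then 0 else (q : PadicAlgCl 2)) * (q : PadicAlgCl 2)⁻¹ *
        ∑ k ∈ Fintype.piFinset (fun _ : S₀ ↦ Finset.range 3),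
          (∏ v : S₀, (1 - C (embCoeff g ι (Rat.HeightOneSpectrum.natGenerator (v : IsDedekindDomain.HeightOneSpectrum (NumberField.RingOfIntegers ℚ)))) * X + (if Rat.HeightOneSpectrum.natGenerator (v : IsDedekindDomain.HeightOneSpectrum (NumberField.RingOfIntegers ℚ)) ∣ M then 0 else C (Rat.HeightOneSpectrum.natGenerator (v : IsDedekindDomain.HeightOneSpectrum (NumberField.RingOfIntegers ℚ)) : PadicAlgCl 2)) * X ^ 2 : (PadicAlgCl 2)[X]).coeff (k v) *
              ((Rat.HeightOneSpectrum.natGenerator (v : IsDedekindDomain.HeightOneSpectrum (NumberField.RingOfIntegers ℚ)) : PadicAlgCl 2)⁻¹) ^ (k v)) *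
            ι (plusSymbolK g Ω ((q : ℚ) * r * ((∏ v : S₀, Rat.HeightOneSpectrum.natGenerator (v : IsDedekindDomain.HeightOneSpectrum (NumberField.RingOfIntegers ℚ)) ^ (k v) : ℕ) : ℚ))) := by
  have hper : ∀ (x : ℚ) (k : ℤ), ι (plusSymbolK g Ω (x + k)) = ι (plusSymbolK g Ω x) := fun x k ↦ by
    rw [plusSymbolK_add_intCast]
  have h := (heckeRel_act_prod_depletionFactor (fun x ↦ ι (plusSymbolK g Ω x)) hper hq.pos
    (heckeRel_embPlusSymbol ι hg hΩ hq) S₀ (fun v ↦ Rat.HeightOneSpectrum.natGenerator v)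
    (fun v hv ↦ (Nat.coprime_primes (Rat.HeightOneSpectrum.prime_natGenerator v) hq).mpr (hqS v hv))
    (fun v k ↦ (1 - C (embCoeff g ι (Rat.HeightOneSpectrum.natGenerator v)) * X +
      (if Rat.HeightOneSpectrum.natGenerator v ∣ M then 0 else C (Rat.HeightOneSpectrum.natGenerator v : PadicAlgCl 2)) *
        X ^ 2 : (PadicAlgCl 2)[X]).coeff k * ((Rat.HeightOneSpectrum.natGenerator v : PadicAlgCl 2)⁻¹) ^ k)).2 r
  simp only [act_prod_depletionFactor_eq_sum_piFinset (fun y ↦ ι (plusSymbolK g Ω y))] at h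
  exact h

/-- **`U_ℓ φ^{S₀}_{g,Ω} = 0` for `ℓ = ℓ_{v₀}`, `v₀ ∈ S₀`**: the `S₀`-depleted plus symbol of a newform `g` (plus period `Ω`)
is killed by `U_ℓ` at every place of `S₀`: `∑_{j<ℓ} φ^{S₀}((r+j)/ℓ) = 0` for all `r`. (The factor at `v₀` of the depletion
operator is `[1] − ι a_ℓ ℓ⁻¹[ℓ] + 𝟙_{ℓ∤M} ℓ⁻¹[ℓ²]`, killed by `U_ℓ` thanks to the Hecke relation at `ℓ`; the other factors
involve primes `≠ ℓ` and preserve that relation.) [cite: GreenbergVatsal2000, §1 (8) and §3 (U_ℓ acts by 0 on the Σ₀-depleted form)] -/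
theorem heckeU_depletedPartnerSymbol_eq_zero (hg : IsNewform0 g) (hΩ : IsPlusPeriod g Ω)
    (S₀ : Finset (IsDedekindDomain.HeightOneSpectrum (NumberField.RingOfIntegers ℚ)))
    {v₀ : IsDedekindDomain.HeightOneSpectrum (NumberField.RingOfIntegers ℚ)} (hv₀ : v₀ ∈ S₀) (r : ℚ) :
    ∑ j : Fin (Rat.HeightOneSpectrum.natGenerator v₀), ∑ k ∈ Fintype.piFinset (fun _ : S₀ ↦ Finset.range 3),
        (∏ v : S₀, (1 - C (embCoeff g ι (Rat.HeightOneSpectrum.natGenerator (v : IsDedekindDomain.HeightOneSpectrum (NumberField.RingOfIntegers ℚ)))) * X + (if Rat.HeightOneSpectrum.natGenerator (v : IsDedekindDomain.HeightOneSpectrum (NumberField.RingOfIntegers ℚ)) ∣ M then 0 else C (Rat.HeightOneSpectrum.natGenerator (v : IsDedekindDomain.HeightOneSpectrum (NumberField.RingOfIntegers ℚ)) : PadicAlgCl 2)) * X ^ 2 : (PadicAlgCl 2)[X]).coeff (k v) *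
            ((Rat.HeightOneSpectrum.natGenerator (v : IsDedekindDomain.HeightOneSpectrum (NumberField.RingOfIntegers ℚ)) : PadicAlgCl 2)⁻¹) ^ (k v)) *
          ι (plusSymbolK g Ω ((r + j) / (Rat.HeightOneSpectrum.natGenerator v₀) *
            ((∏ v : S₀, Rat.HeightOneSpectrum.natGenerator (v : IsDedekindDomain.HeightOneSpectrum (NumberField.RingOfIntegers ℚ)) ^ (k v) : ℕ) : ℚ))) = 0 := by
  have hper : ∀ (x : ℚ) (k : ℤ), ι (plusSymbolK g Ω (x + k)) = ι (plusSymbolK g Ω x) := fun x k ↦ by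
    rw [plusSymbolK_add_intCast]
  have hprime := Rat.HeightOneSpectrum.prime_natGenerator v₀
  obtain ⟨h0, h1, h2⟩ := coeff_partnerEulerPolynomial (embCoeff g ι (Rat.HeightOneSpectrum.natGenerator v₀)) M
    (Rat.HeightOneSpectrum.natGenerator v₀)
  have h := heckeU_act_prod_depletionFactor_eq_zero (fun x ↦ ι (plusSymbolK g Ω x)) hper S₀
    (fun v ↦ Rat.HeightOneSpectrum.natGenerator v)
    (fun v k ↦ (1 - C (embCoeff g ι (Rat.HeightOneSpectrum.natGenerator v)) * X +
      (if Rat.HeightOneSpectrum.natGenerator v ∣ M then 0 else C (Rat.HeightOneSpectrum.natGenerator v : PadicAlgCl 2)) *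
        X ^ 2 : (PadicAlgCl 2)[X]).coeff k * ((Rat.HeightOneSpectrum.natGenerator v : PadicAlgCl 2)⁻¹) ^ k)
    hv₀ hprime.pos (by exact_mod_cast hprime.ne_zero) (fun v _ hne ↦ coprime_natGenerator_of_ne hne)
    (heckeRel_embPlusSymbol ι hg hΩ hprime) (by rw [h0, pow_zero, one_mul]) (by rw [h1, pow_one, neg_mul])
    (by rw [h2]) r
  simp only [act_prod_depletionFactor_eq_sum_piFinset (fun y ↦ ι (plusSymbolK g Ω y))] at h
  exact h

end Partner

end Summit.BirchSwinnertonDyer.BirchSwinnertonDyer.Theorems.ThetaLayerLambdaCongruenceAtTwo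

end
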